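import Summits.NavierStokesRegularity.FunctionalMining.TopEigStrainMixHeat
import Summits.NavierStokesRegularity.FunctionalMining.ThreeWaveStrain
import HarnessLib

/-!
# The symmetrised core `Φ₂ + Ψ₂ = ∫λ₁² + ∫|λ₃|²` IS heat-coercive on `T³`:
# `HeatCoercive (topBotEigMoment 2) (2/81)`, hence `TopBotEigHeatCoercivePos 2` (door D-K6 (c))

NS FUNCTIONAL MINING — search for candidate a priori estimates; no regularity claim.

Cell `pub-nsfunc`, no-go seat (gen 37): STAGED kernel node deciding the `q = 2` instance of the
census-minted open item `TopBotEigHeatCoercivePos q` (`SpectralMixtureCandidates.lean`; OPEN for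
every real `q ≥ 2` on the record NOGO v7.137 / (W-5): W18 kills `Φ_q + Ψ_q` from neither sign,
no two-well wall does, no rate on record) POSITIVELY, with an explicit rate, from tree facts only:
* §1 `|S(x)|² = ∑ₖ λₖ(x)²` (spectral theorem, tree `ThreeWaveStrain`) and the sorted `λ₁ ≥ λ₂ ≥ λ₃`
  of `T³` as a `Fin 3`-family `eig3` (`λ₁ = torusStrainTopEig`, `λ₃ = torusStrainBotEig`,
  `λ₁ + λ₂ + λ₃ = 0` for divergence-free fields);
* §2 the POINTWISE IDENTITY on trace-free symmetric `3 × 3` tensors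
  `λ₁² + λ₃² = |S|²/3 + (λ₁−λ₃)²/3`, written with the tree's Rayleigh functional `lam`:
  `λ(S)² + λ(−S)² = ‖S‖²/3 + (4/3)·g(S)²`, `g(A) = (λ(A) + λ(−A))/2` (`gapDensity`, half the
  spectral gap), and the bound `λ(S)² + λ(−S)² ≤ ‖S‖²`;
* §3 `g` is ADMISSIBLE (convex, `1`-Lipschitz, `≥ 0`), so the gap moment `G = ∫ g(S)²` passes
  the tree's heat sieve `heatDissipation_nonneg_of_admissible` and its heat line is convex;
* §4 the `Z₂` heat line is the parabola `Z₂(v + τw) = Z₂(v) + 2τ∫⟨S(v),S(w)⟩ + τ²Z₂(w)`, the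
  pairing at `w = Δv` is `−D₂(v)`, `D₂ = strainGradDissipation 2 = ∫∑ₖ|∂ₖS|²` (`StrainViscous`,
  identity weight), and the codomain-generic Poincaré inequality gives `Z₂ ≤ 27·D₂`;
* §5 THE DISSIPATION IDENTITY `heatDissipation (Φ₂+Ψ₂) v = (2/3)·D₂(v) + (4/3)·heatDissipation G v`
  (right derivatives along the heat line add; `Φ₂ + Ψ₂ = Z₂/3 + (4/3)G` on divergence-free
  fields), hence `heatDissipation (Φ₂+Ψ₂) v ≥ (2/3)D₂ ≥ (2/81)Z₂ ≥ (2/81)(Φ₂+Ψ₂)`: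
  **`topBotEigMoment_two_heatCoercive : HeatCoercive (topBotEigMoment 2) (2/81)`** and
  **`topBotEigHeatCoercivePos_two : TopBotEigHeatCoercivePos (d := Fin 3) 2`**.
The rate `2/81` comes from the tree's Poincaré constant `d³ = 27`; the sharp torus constant `4π²`
would give `8π²/3` (pen only; K6's kernel ceiling is `8π²`). With the STAGED node K5
(`topBotEigMomentLaw_of_heatCoercivePos`, REQUEST #19, not in the tree) this yields the symmetrised
saturating law `TopBotEigMomentLaw 2`; that corollary is NOT in this file. Real `q > 2` (uniform
convexity of `λ₁^q + |λ₃|^q` relative to `|S|^q` on trace-free tensors + the nonlinear Poincaré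
`strainMoment_le_npConst_mul`) is a PEN theorem of the seat, one-party, not typed here. Nothing
about Navier–Stokes regularity or blow-up: every statement is an inequality between candidate
a priori functionals at a fixed smooth divergence-free field. Who checked what: no-go seat g37
typed and farm-checked this file; STATUS: STAGED (`pub-nsfunc-nogo/NoGo/TopBotEigHeatCoerciveTwo
.STAGING.lean`), filing by a prove seat on the lead's word. [ours; K1-Q6 (c), heat side, `q = 2`]
FILING (prove seat g26, REQUEST #21): declarations byte-identical to the no-go seat's staged `TopBotEigHeatCoerciveTwo.STAGING.lean` c363eaeab141d45f; this line is the only addition.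
-/

noncomputable section

open MeasureTheory Set Filter Topology Finset
open scoped InnerProductSpace RealInnerProductSpace ContDiff

namespace Summit.NavierStokesRegularity.FunctionalMining

open Literature.Analysis.FunctionSpaces Literature.Analysis.FunctionSpaces.Torus
  Literature.Analysis.FluidPDE

namespace TopEig

open StrainL4 StrainMoment

/-! ## 1. Spectral bookkeeping: `|S|² = ∑ₖ λₖ²`, and the three sorted eigenvalues on `T³` -/

/-- **`|S(x)|² = ∑ₖ λₖ(x)²`** (any dimension; `tr S² = ∑ Sᵢⱼ² = ∑ λₖ²` by the tree's
`MiddleEigenKill.trace_mul_self_eq_sum_sq[_entries]`, `ThreeWaveStrain.lean`). [folklore] -/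
theorem torusStrainSqAt_eq_sum_eig_sq {d : Type*} [Fintype d] [DecidableEq d]
    (v : UnitAddTorus d → EuclideanSpace ℝ d) (x : UnitAddTorus d) :
    torusStrainSqAt v x = ∑ k, torusStrainEig v x k ^ 2 := by
  have h1 : torusStrainSqAt v x = (torusStrainMatrix v x * torusStrainMatrix v x).trace := by
    rw [MiddleEigenKill.trace_mul_self_eq_sum_sq_entries (torusStrainMatrix_isSymm v x)]
    simp only [torusStrainSqAt, torusStrainMatrix, Matrix.of_apply]
  rw [h1, MiddleEigenKill.trace_mul_self_eq_sum_sq (torusStrainMatrix_isHermitian v x)]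
  unfold torusStrainEig
  exact Fintype.sum_equiv (Fintype.equivOfCardEq (Fintype.card_fin _)).symm _ _ fun i => rfl

/-- Velocity fields on `T³` (local shorthand). -/
local notation "𝕍₃" => UnitAddTorus (Fin 3) → EuclideanSpace ℝ (Fin 3)

/-- The three sorted strain eigenvalues `λ₁ ≥ λ₂ ≥ λ₃` on `T³` as a `Fin 3`-family
(`eig3 v x 0 = λ₁(x)`, `· 1 = λ₂(x)`, `· 2 = λ₃(x)`). [ours, bookkeeping] -/
def eig3 (v : 𝕍₃) (x : UnitAddTorus (Fin 3)) (i : Fin 3) : ℝ :=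
  torusStrainEig v x (Fin.cast (Fintype.card_fin 3).symm i)

variable {v w : 𝕍₃}

/-- `eig3` is sorted decreasingly. [folklore] -/
theorem eig3_antitone (v : 𝕍₃) (x : UnitAddTorus (Fin 3)) : Antitone (eig3 v x) := fun _ _ hab =>
  torusStrainEig_antitone v x ((Fin.cast_le_cast _).mpr hab)

/-- `λ₁ + λ₂ + λ₃ = 0` for smooth divergence-free fields. [folklore] -/
theorem eig3_sum_eq_zero (hv : Torus.IsSmooth v) (hdiv : Torus.IsDivFree v)
    (x : UnitAddTorus (Fin 3)) : eig3 v x 0 + eig3 v x 1 + eig3 v x 2 = 0 := by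
  have h := sum_torusStrainEig_eq_zero hv hdiv x
  rwa [← Equiv.sum_comp (finCongr (Fintype.card_fin 3).symm) (torusStrainEig v x),
    Fin.sum_univ_three] at h

/-- `|S(x)|² = λ₁² + λ₂² + λ₃²` on `T³`. [folklore] -/
theorem torusStrainSqAt_eq_eig3 (v : 𝕍₃) (x : UnitAddTorus (Fin 3)) :
    torusStrainSqAt v x = eig3 v x 0 ^ 2 + eig3 v x 1 ^ 2 + eig3 v x 2 ^ 2 := by
  rw [torusStrainSqAt_eq_sum_eig_sq,
    ← Equiv.sum_comp (finCongr (Fintype.card_fin 3).symm) (fun k => torusStrainEig v x k ^ 2),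
    Fin.sum_univ_three]
  rfl

/-- `λ₁ = torusStrainTopEig`. [bookkeeping] -/
theorem torusStrainTopEig_eq_eig3 (v : 𝕍₃) (x : UnitAddTorus (Fin 3)) :
    torusStrainTopEig v x = eig3 v x 0 := by
  unfold torusStrainTopEig
  rw [← (finCongr (Fintype.card_fin 3).symm).iSup_comp]
  exact le_antisymm (ciSup_le fun i => eig3_antitone v x (show (0 : Fin 3) ≤ i from Nat.zero_le _))
    (le_ciSup (f := eig3 v x) (Set.finite_range _).bddAbove 0)

/-- `λ₃ = torusStrainBotEig`. [bookkeeping] -/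
theorem torusStrainBotEig_eq_eig3 (v : 𝕍₃) (x : UnitAddTorus (Fin 3)) :
    torusStrainBotEig v x = eig3 v x 2 := by
  unfold torusStrainBotEig
  rw [← (finCongr (Fintype.card_fin 3).symm).iInf_comp]
  refine le_antisymm (ciInf_le (f := eig3 v x) (Set.finite_range _).bddBelow 2)
    (le_ciInf fun i => eig3_antitone v x (Fin.le_last i))

/-! ## 2. The pointwise identity `λ₁² + λ₃² = |S|²/3 + (λ₁ − λ₃)²/3` -/

/-- **Half the spectral gap** `g(A) = (λ(A) + λ(−A))/2` (`= (λ₁ − λ₃)/2` on symmetric tensors).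
[ours; the admissible density of the symmetrised core] -/
def gapDensity (A : EuclideanSpace ℝ (Fin 3 × Fin 3)) : ℝ := (lam A + lam (-A)) / 2

/-- **`λ(S)² + λ(−S)² = ‖S‖²/3 + (4/3)·g(S)²`** at every point of a smooth divergence-free field on
`T³` (`λ₁² + λ₃² = |S|²/3 + (λ₁−λ₃)²/3`, from `λ₂ = −λ₁−λ₃` and `|S|² = ∑λₖ²`). [ours] -/
theorem lam_sq_add_lam_neg_sq (hv : Torus.IsSmooth v) (hdiv : Torus.IsDivFree v)
    (x : UnitAddTorus (Fin 3)) :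
    lam (strainFlat v x) ^ 2 + lam (-strainFlat v x) ^ 2 =
      ‖strainFlat v x‖ ^ 2 / 3 + 4 / 3 * gapDensity (strainFlat v x) ^ 2 := by
  rw [gapDensity, lam_neg_strainFlat, lam_strainFlat, norm_strainFlat_sq, torusStrainSqAt_eq_eig3,
    torusStrainTopEig_eq_eig3, torusStrainBotEig_eq_eig3]
  have hm : eig3 v x 1 = -eig3 v x 0 - eig3 v x 2 := by linarith [eig3_sum_eq_zero hv hdiv x]
  rw [hm]
  ring

/-- `λ(S)² + λ(−S)² ≤ ‖S‖²` pointwise (`λ₁² + λ₃² ≤ ∑λₖ²`). [ours] -/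
theorem lam_sq_add_lam_neg_sq_le (v : 𝕍₃) (x : UnitAddTorus (Fin 3)) :
    lam (strainFlat v x) ^ 2 + lam (-strainFlat v x) ^ 2 ≤ ‖strainFlat v x‖ ^ 2 := by
  rw [lam_neg_strainFlat, lam_strainFlat, norm_strainFlat_sq, torusStrainSqAt_eq_eig3,
    torusStrainTopEig_eq_eig3, torusStrainBotEig_eq_eig3]
  nlinarith [sq_nonneg (eig3 v x 1)]

/-! ## 3. The gap density is admissible; the gap moment passes the heat sieve -/

/-- `g` is convex. [folklore] -/
theorem convexOn_gapDensity : ConvexOn ℝ univ gapDensity := by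
  have h := ((convexOn_lam (d := Fin 3)).add (convexOn_lam_neg (d := Fin 3))).smul
    (show (0 : ℝ) ≤ 1 / 2 by norm_num)
  refine h.congr fun A _ => ?_
  simp only [Pi.add_apply, smul_eq_mul, gapDensity]
  ring

/-- `g` is `1`-Lipschitz. [folklore] -/
theorem lipschitzWith_gapDensity : LipschitzWith 1 gapDensity :=
  LipschitzWith.of_dist_le_mul fun A B => by
    have h1 := abs_lam_sub_lam_le (d := Fin 3) A B
    have h2 := abs_lam_sub_lam_le (d := Fin 3) (-A) (-B)
    rw [← neg_sub' , norm_neg] at h2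
    rw [Real.dist_eq, NNReal.coe_one, one_mul, dist_eq_norm]
    unfold gapDensity
    rw [show (lam A + lam (-A)) / 2 - (lam B + lam (-B)) / 2 =
      ((lam A - lam B) + (lam (-A) - lam (-B))) / 2 by ring, abs_div, abs_two]
    have h3 := abs_add_le (lam A - lam B) (lam (-A) - lam (-B))
    linarith

/-- `g ≥ 0` (`λ` convex with `λ(0) = 0`). [folklore] -/
theorem gapDensity_nonneg (A : EuclideanSpace ℝ (Fin 3 × Fin 3)) : 0 ≤ gapDensity A := by
  have h := (convexOn_lam (d := Fin 3)).2 (mem_univ A) (mem_univ (-A))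
    (show (0 : ℝ) ≤ 1 / 2 by norm_num) (show (0 : ℝ) ≤ 1 / 2 by norm_num) (by norm_num)
  have e : (1 / 2 : ℝ) • A + (1 / 2 : ℝ) • (-A) = 0 := by rw [smul_neg, add_neg_cancel]
  rw [e, lam_zero] at h
  simp only [smul_eq_mul] at h
  unfold gapDensity
  linarith

/-- **The gap moment** `G(v) = ∫ g(S(x))² dx`. [ours; candidate a priori functional] -/
def gapMoment (v : 𝕍₃) : ℝ :=
  ∫ x, gapDensity (strainFlat v x) ^ (2 : ℝ)

/-- The gap moment passes the heat sieve: `0 ≤ heatDissipation G v`. [ours] -/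
theorem heatDissipation_gapMoment_nonneg (hv : Torus.IsSmooth v) (hdiv : Torus.IsDivFree v) :
    0 ≤ heatDissipation gapMoment v :=
  heatDissipation_nonneg_of_admissible (q := 2) (by norm_num) convexOn_gapDensity
    lipschitzWith_gapDensity (fun _ _ _ x => gapDensity_nonneg _) (fun _ _ _ => rfl) hv hdiv

/-- The gap moment is convex along lines. [ours] -/
theorem convexOn_gapMoment_line (hv : Torus.IsSmooth v) (hw : Torus.IsSmooth w) :
    ConvexOn ℝ univ (fun t : ℝ => gapMoment (v + t • w)) := by
  have h := convexOn_integral_posPart_rpow_line (d := Fin 3) convexOn_gapDensity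
    lipschitzWith_gapDensity.continuous (continuous_strainFlat hv) (continuous_strainFlat hw)
    (q := 2) (by norm_num)
  refine h.congr fun t _ => ?_
  unfold gapMoment
  refine integral_congr_ae (ae_of_all _ fun x => ?_)
  show max (gapDensity (strainFlat v x + t • strainFlat w x)) 0 ^ (2 : ℝ) =
    gapDensity (strainFlat (v + t • w) x) ^ (2 : ℝ)
  rw [← strainFlat_add_smul (hv.isContDiff (by simp)) (hw.isContDiff (by simp)),
    max_eq_left (gapDensity_nonneg _)]

/-! ## 4. The `Z₂` heat line: exact parabola, pairing `= −D₂`, Poincaré `Z₂ ≤ 27 D₂` -/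

/-- `Z₂(v) = ∫ ‖S‖²`. [bookkeeping] -/
theorem strainMoment_two_eq (v : 𝕍₃) : torusStrainMoment 2 v = ∫ x, ‖strainFlat v x‖ ^ 2 := by
  unfold torusStrainMoment
  refine integral_congr_ae (ae_of_all _ fun x => ?_)
  show torusStrainSqAt v x ^ ((2 : ℝ) / 2) = ‖strainFlat v x‖ ^ 2
  rw [div_self two_ne_zero, Real.rpow_one, norm_strainFlat_sq]

/-- **The `Z₂` line is a parabola**: `Z₂(v + τw) = Z₂(v) + 2τ∫⟨S(v),S(w)⟩ + τ²∫‖S(w)‖²`. [ours] -/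
theorem strainMoment_two_line (hv : Torus.IsSmooth v) (hw : Torus.IsSmooth w) (τ : ℝ) :
    torusStrainMoment 2 (v + τ • w) = torusStrainMoment 2 v +
      2 * τ * (∫ x, ⟪strainFlat v x, strainFlat w x⟫_ℝ) + τ ^ 2 * ∫ x, ‖strainFlat w x‖ ^ 2 := by
  have hS := continuous_strainFlat hv
  have hB := continuous_strainFlat hw
  have i1 : Integrable (fun x => ‖strainFlat v x‖ ^ 2) := (hS.norm.pow 2).integrable_unitAddTorus
  have i2 : Integrable (fun x => 2 * τ * ⟪strainFlat v x, strainFlat w x⟫_ℝ) :=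
    ((hS.inner hB).const_mul _).integrable_unitAddTorus
  have i3 : Integrable (fun x => τ ^ 2 * ‖strainFlat w x‖ ^ 2) :=
    ((hB.norm.pow 2).const_mul _).integrable_unitAddTorus
  have i12 : Integrable
      (fun x => ‖strainFlat v x‖ ^ 2 + 2 * τ * ⟪strainFlat v x, strainFlat w x⟫_ℝ) := i1.add i2
  rw [strainMoment_line_eq 2 hv hw τ, strainMoment_two_eq, ← integral_const_mul,
    ← integral_const_mul, ← integral_add i1 i2, ← integral_add i12 i3]
  refine integral_congr_ae (ae_of_all _ fun x => ?_)
  show (‖strainFlat v x + τ • strainFlat w x‖ ^ 2) ^ ((2 : ℝ) / 2) = _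
  rw [div_self two_ne_zero, Real.rpow_one, norm_add_sq_real, real_inner_smul_right, norm_smul,
    mul_pow, Real.norm_eq_abs, sq_abs]
  ring

/-- **The pairing along the heat line is minus the strain-gradient dissipation**:
`∫⟨S(v), S(Δv)⟩ = −D₂(v)`, `D₂ = strainGradDissipation 2 = ∫∑ₖ∑ᵢⱼ(∂ₖSᵢⱼ)²`. [ours] -/
theorem integral_inner_strainFlat_laplacian (hv : Torus.IsSmooth v) :
    ∫ x, ⟪strainFlat v x, strainFlat (Torus.laplacian v) x⟫_ℝ = -strainGradDissipation 2 v := by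
  have hd1 : deriv (id : ℝ → ℝ) = fun _ => (1 : ℝ) := by funext s; exact deriv_id s
  have hd2 : deriv (deriv (id : ℝ → ℝ)) = fun _ => (0 : ℝ) := by
    rw [hd1]; funext s; exact deriv_const s 1
  have e : ∀ x, ⟪strainFlat v x, strainFlat (Torus.laplacian v) x⟫_ℝ =
      deriv id (torusStrainSqAt v x) * ∑ i, ∑ j,
        (Torus.partialDeriv j v x i + Torus.partialDeriv i v x j) / 2 *
          Torus.partialDeriv i (Torus.laplacian v) x j := by
    intro x
    rw [inner_strainFlat_laplacian, hd1, one_mul]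
  simp_rw [e]
  rw [GradientTensor.integral_deriv_comp_strainSqAt_mul_sum_strain_laplacian hv isOpen_univ
    contDiff_id.contDiffOn (fun x => mem_univ _), hd2, hd1]
  unfold strainGradDissipation
  simp only [zero_mul, integral_zero, mul_zero, sub_zero, one_mul, neg_inj]
  refine integral_congr_ae (ae_of_all _ fun x => ?_)
  simp only [show (2 : ℝ) / 2 - 1 = 0 by norm_num, Real.rpow_zero, one_mul]

/-- **Poincaré for the strain on `T³`** (tree constant `d³ = 27`): `Z₂(v) ≤ 27·D₂(v)`. [folklore] -/
theorem strainMoment_two_le (hv : Torus.IsSmooth v) :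
    torusStrainMoment 2 v ≤ 27 * strainGradDissipation 2 v := by
  have h := CodomainSobolev.integral_norm_sq_le_card_cube_mul (isSmooth_strainFlat hv)
    (hasZeroMean_strainFlat hv)
  have e : (∫ x, ∑ k, ‖Torus.partialDeriv k (strainFlat v) x‖ ^ 2) = strainGradDissipation 2 v := by
    unfold strainGradDissipation
    refine integral_congr_ae (ae_of_all _ fun x => ?_)
    show (∑ k, ‖Torus.partialDeriv k (strainFlat v) x‖ ^ 2) = _
    rw [sum_norm_partialDeriv_strainFlat_sq hv]
    simp only [show (2 : ℝ) / 2 - 1 = 0 by norm_num, Real.rpow_zero, one_mul]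
  rw [strainMoment_two_eq, ← e]
  have hc : ((Fintype.card (Fin 3) : ℕ) : ℝ) ^ 3 = 27 := by norm_num
  rw [hc] at h
  exact h

/-! ## 5. The dissipation identity and the coercivity of `Φ₂ + Ψ₂` -/

/-- `Φ₂ + Ψ₂ = ∫ (λ(S)² + λ(−S)²)` on smooth divergence-free fields of `T³`. [bookkeeping] -/
theorem topBotEigMoment_two_eq_integral (hv : Torus.IsSmooth v) (hdiv : Torus.IsDivFree v) :
    topBotEigMoment (d := Fin 3) 2 v =
      ∫ x, (lam (strainFlat v x) ^ 2 + lam (-strainFlat v x) ^ 2) := by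
  have hS := continuous_strainFlat hv
  have i1 : Integrable (fun x => lam (strainFlat v x) ^ (2 : ℝ)) :=
    ((continuous_lam.comp hS).rpow_const fun _ => Or.inr (by norm_num)).integrable_unitAddTorus
  have i2 : Integrable (fun x => lam (-strainFlat v x) ^ (2 : ℝ)) :=
    ((continuous_lam.comp hS.neg).rpow_const fun _ => Or.inr (by norm_num)).integrable_unitAddTorus
  unfold topBotEigMoment
  rw [torusTopEigMoment_eq hv hdiv, torusNegBotEigMoment_eq hv hdiv, ← integral_add i1 i2]
  refine integral_congr_ae (ae_of_all _ fun x => ?_)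
  show lam (strainFlat v x) ^ (2 : ℝ) + lam (-strainFlat v x) ^ (2 : ℝ) = _
  rw [Real.rpow_two, Real.rpow_two]

/-- **`Φ₂ + Ψ₂ = Z₂/3 + (4/3)·G`** on smooth divergence-free fields of `T³`. [ours] -/
theorem topBotEigMoment_two_eq (hv : Torus.IsSmooth v) (hdiv : Torus.IsDivFree v) :
    topBotEigMoment (d := Fin 3) 2 v = torusStrainMoment 2 v / 3 + 4 / 3 * gapMoment v := by
  have hS := continuous_strainFlat hv
  have j1 : Integrable (fun x => ‖strainFlat v x‖ ^ 2 / 3) :=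
    ((hS.norm.pow 2).div_const _).integrable_unitAddTorus
  have j2 : Integrable (fun x => 4 / 3 * gapDensity (strainFlat v x) ^ 2) :=
    (((lipschitzWith_gapDensity.continuous.comp hS).pow 2).const_mul _).integrable_unitAddTorus
  have eG : gapMoment v = ∫ x, gapDensity (strainFlat v x) ^ 2 := by
    unfold gapMoment
    exact integral_congr_ae (ae_of_all _ fun x => Real.rpow_two _)
  rw [topBotEigMoment_two_eq_integral hv hdiv, strainMoment_two_eq, eG, ← integral_div,
    ← integral_const_mul, ← integral_add j1 j2]
  exact integral_congr_ae (ae_of_all _ fun x => lam_sq_add_lam_neg_sq hv hdiv x)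

/-- `Φ₂ + Ψ₂ ≤ Z₂` on smooth divergence-free fields. [ours] -/
theorem topBotEigMoment_two_le (hv : Torus.IsSmooth v) (hdiv : Torus.IsDivFree v) :
    topBotEigMoment (d := Fin 3) 2 v ≤ torusStrainMoment 2 v := by
  have hS := continuous_strainFlat hv
  rw [topBotEigMoment_two_eq_integral hv hdiv, strainMoment_two_eq]
  exact integral_mono ((((continuous_lam.comp hS).pow 2).add
    ((continuous_lam.comp hS.neg).pow 2)).integrable_unitAddTorus)
    (hS.norm.pow 2).integrable_unitAddTorus fun x => lam_sq_add_lam_neg_sq_le v x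

/-- **THE DISSIPATION IDENTITY.** For smooth divergence-free `v` on `T³`:
`heatDissipation (Φ₂+Ψ₂) v = (2/3)·D₂(v) + (4/3)·heatDissipation G v`. [ours] -/
theorem heatDissipation_topBotEigMoment_two (hv : Torus.IsSmooth v) (hdiv : Torus.IsDivFree v) :
    heatDissipation (topBotEigMoment (d := Fin 3) 2) v =
      2 / 3 * strainGradDissipation 2 v + 4 / 3 * heatDissipation gapMoment v := by
  have hΔ : Torus.IsSmooth (Torus.laplacian v) := hv.laplacian
  have hFcvx : ConvexOn ℝ univ
      (fun t : ℝ => topBotEigMoment (d := Fin 3) 2 (v + t • Torus.laplacian v)) := by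
    have h := (convexOn_topEigMoment_line (q := 2) (by norm_num) hv hΔ).add
      (convexOn_negBotEigMoment_line (q := 2) (by norm_num) hv hΔ)
    exact h.congr fun t _ => rfl
  obtain ⟨hderF, heqF⟩ := heatDissipation_eq_neg_rightDeriv (d := Fin 3)
    (Φ := topBotEigMoment (d := Fin 3) 2) (v := v) hFcvx
  obtain ⟨hderG, heqG⟩ := heatDissipation_eq_neg_rightDeriv (d := Fin 3) (Φ := gapMoment) (v := v)
    (convexOn_gapMoment_line hv hΔ)
  rw [heqF, heqG]
  set DF := derivWithin (fun t : ℝ => topBotEigMoment (d := Fin 3) 2 (v + t • Torus.laplacian v))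
    (Set.Ioi 0) 0 with hDF
  set DG := derivWithin (fun t : ℝ => gapMoment (v + t • Torus.laplacian v)) (Set.Ioi 0) 0 with hDG
  have htF := (hasDerivWithinAt_iff_tendsto_slope' self_notMem_Ioi).mp hderF
  have htG := (hasDerivWithinAt_iff_tendsto_slope' self_notMem_Ioi).mp hderG
  set P := ∫ x, ⟪strainFlat v x, strainFlat (Torus.laplacian v) x⟫_ℝ with hP
  set Q := ∫ x, ‖strainFlat (Torus.laplacian v) x‖ ^ 2 with hQ
  -- the slope of `Φ₂+Ψ₂` is `(2P + τQ)/3 + (4/3)·(slope of G)` for every `τ > 0`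
  have hev : ∀ᶠ τ in 𝓝[>] (0 : ℝ),
      slope (fun t : ℝ => topBotEigMoment (d := Fin 3) 2 (v + t • Torus.laplacian v)) 0 τ =
        (2 * P + τ * Q) / 3 +
          4 / 3 * slope (fun t : ℝ => gapMoment (v + t • Torus.laplacian v)) 0 τ := by
    filter_upwards [self_mem_nhdsWithin] with τ (hτ : 0 < τ)
    have hvt : Torus.IsSmooth (v + τ • Torus.laplacian v) := isSmooth_heatLine hv τ
    have hdt : Torus.IsDivFree (v + τ • Torus.laplacian v) :=
      isDivFree_add_smul hv hΔ hdiv (isDivFree_laplacian hv hdiv) τ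
    rw [slope_def_field, slope_def_field]
    simp only [zero_smul, add_zero, sub_zero]
    rw [topBotEigMoment_two_eq hvt hdt, topBotEigMoment_two_eq hv hdiv,
      strainMoment_two_line hv hΔ τ, ← hP, ← hQ]
    field_simp
    ring
  have hlim : Tendsto (fun τ : ℝ => (2 * P + τ * Q) / 3 +
      4 / 3 * slope (fun t : ℝ => gapMoment (v + t • Torus.laplacian v)) 0 τ)
      (𝓝[>] (0 : ℝ)) (𝓝 ((2 * P + 0 * Q) / 3 + 4 / 3 * DG)) := by
    refine Tendsto.add ?_ (htG.const_mul _)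
    have hc : Continuous fun τ : ℝ => (2 * P + τ * Q) / 3 :=
      (continuous_const.add (continuous_id.mul continuous_const)).div_const _
    exact (hc.tendsto 0).mono_left nhdsWithin_le_nhds
  have hDFeq : DF = (2 * P + 0 * Q) / 3 + 4 / 3 * DG := tendsto_nhds_unique (htF.congr' hev) hlim
  rw [hDFeq, hP, integral_inner_strainFlat_laplacian hv]
  ring

/-- **`Φ₂ + Ψ₂` is heat-coercive at rate `2/81`**: every smooth divergence-free zero-mean `v` on
`T³` has `(2/81)·(Φ₂+Ψ₂)(v) ≤ heatDissipation (Φ₂+Ψ₂) v`. [ours; door D-K6 (c) at `q = 2`] -/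
theorem topBotEigMoment_two_heatCoercive :
    HeatCoercive (d := Fin 3) (topBotEigMoment 2) (2 / 81) := by
  intro _ v hv hdiv _
  rw [heatDissipation_topBotEigMoment_two hv hdiv]
  have hG := heatDissipation_gapMoment_nonneg hv hdiv
  have hZ := strainMoment_two_le hv
  have hF := topBotEigMoment_two_le hv hdiv
  linarith

/-- **`TopBotEigHeatCoercivePos 2` holds** (lemma L-λ for the symmetrised core at `q = 2`; with the
staged node K5 `topBotEigMomentLaw_of_heatCoercivePos` it gives `TopBotEigMomentLaw 2`). [ours] -/
theorem topBotEigHeatCoercivePos_two : TopBotEigHeatCoercivePos (d := Fin 3) 2 :=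
  ⟨2 / 81, by norm_num, topBotEigMoment_two_heatCoercive⟩

end TopEig

end Summit.NavierStokesRegularity.FunctionalMining

end
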